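import Literature.Analysis.Complex.RiemannMapping
import Literature.Probability.RandomPlanarGeometry.CaratheodoryHalfPlane
import HarnessLib

/-!
# The Riemann mapping theorem for `Literature.Probability.RandomPlanarGeometry.ConformalEquiv`: discharges of the named facts

`Literature.Probability.RandomPlanarGeometry.ConformalMap` states the Riemann mapping theorem as
the named facts `Literature.Probability.RandomPlanarGeometry.exists_conformalEquiv_ball` (disc form) and
`Literature.Probability.RandomPlanarGeometry.exists_conformalEquiv_upperHalfPlaneSet` (half-plane form). (The sibling file
`ConformalMapProofs.lean` discharges `Literature.Probability.RandomPlanarGeometry.ConformalEquiv.isOpen_target`; the present file is kept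
separate because it needs the heavier import `Literature.Analysis.Complex.RiemannMapping`.)
This file discharges both from
the Riemann mapping theorem proved in `Literature.Analysis.Complex.RiemannMapping`
(`Complex.exists_bijOn_ball_differentiableOn_invFunOn`, Conway VII.4.2), packaging the holomorphic
bijection with holomorphic inverse `Function.invFunOn f U` as an `Literature.ConformalEquiv U 𝔻`
(`Set.BijOn.toPartialEquiv`), and composing with the Cayley transform for the half-plane form
(`Literature.Probability.RandomPlanarGeometry.exists_conformalEquiv_upperHalfPlaneSet_of_ball` of
`Literature.Probability.RandomPlanarGeometry.CaratheodoryHalfPlane`).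

As a consequence the hypothesis `hRM` of
`Literature.Probability.RandomPlanarGeometry.MarkedDomain.exists_isChordalUniformizing_of_disc` is discharged
(`Literature.Probability.RandomPlanarGeometry.MarkedDomain.exists_isChordalUniformizing_of_caratheodory`): chordal uniformizing maps of
Dobrushin domains exist given only simple connectivity of Jordan domains (Jordan–Schoenflies) and
Carathéodory's theorem in disc form.

## Mathlib

We USE `Set.BijOn.toPartialEquiv` (a `BijOn` map as a `PartialEquiv` with inverse
`Function.invFunOn`), `IsSimplyConnected`, `Metric.ball`.

## References

* L. V. Ahlfors, *Complex Analysis*, 3rd ed. (1979), Ch. 6 §1.1, Thm 1 (Riemann mapping theorem).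
* J. B. Conway, *Functions of One Complex Variable I*, 2nd ed., GTM 11 (1978), Ch. VII Thm 4.2.
-/

noncomputable section

open Set Filter Topology Complex Metric
open UpperHalfPlane (upperHalfPlaneSet isOpen_upperHalfPlaneSet)

namespace Literature.Probability.RandomPlanarGeometry

/-! ### The Riemann mapping theorem, disc form -/

/-- A holomorphic bijection `f : U → V` whose inverse `Function.invFunOn f U` is holomorphic on `V`,
bundled as a conformal equivalence `U → V`. Ahlfors (1979), Ch. 6 §1.1. [folklore] -/
def ConformalEquiv.ofBijOn {U V : Set ℂ} (f : ℂ → ℂ) (hf : DifferentiableOn ℂ f U)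
    (hbij : BijOn f U V) (hinv : DifferentiableOn ℂ (Function.invFunOn f U) V) :
    ConformalEquiv U V where
  toPartialEquiv := hbij.toPartialEquiv f U V
  source_eq := rfl
  target_eq := rfl
  differentiableOn := hf
  differentiableOn_symm := hinv

/-- `ConformalEquiv.ofBijOn f _ _ _` acts as `f`. [folklore] -/
@[simp] theorem ConformalEquiv.ofBijOn_apply {U V : Set ℂ} (f : ℂ → ℂ) (hf : DifferentiableOn ℂ f U)
    (hbij : BijOn f U V) (hinv : DifferentiableOn ℂ (Function.invFunOn f U) V) (z : ℂ) :
    ConformalEquiv.ofBijOn f hf hbij hinv z = f z := rfl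

/-- The inverse of `ConformalEquiv.ofBijOn f _ _ _` acts as `Function.invFunOn f U`. [folklore] -/
@[simp] theorem ConformalEquiv.ofBijOn_symm_apply {U V : Set ℂ} (f : ℂ → ℂ)
    (hf : DifferentiableOn ℂ f U) (hbij : BijOn f U V)
    (hinv : DifferentiableOn ℂ (Function.invFunOn f U) V) (w : ℂ) :
    (ConformalEquiv.ofBijOn f hf hbij hinv).symm w = Function.invFunOn f U w := rfl

/-- **The Riemann mapping theorem, disc form** (`Literature.Probability.RandomPlanarGeometry.exists_conformalEquiv_ball` holds): every
simply connected open proper subset `U ⊊ ℂ` is conformally equivalent to the open unit disc.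
Discharged from `Complex.exists_bijOn_ball_differentiableOn_invFunOn` (Conway VII.4.2, proved in
`Literature.Analysis.Complex.RiemannMapping` via Montel, Hurwitz and the Koebe square-root trick).
Ahlfors, *Complex Analysis* (1979), Ch. 6 §1.1, Thm 1. [cite: AhlforsCA1979, Ch. 6 §1.1 Thm. 1] -/
theorem exists_conformalEquiv_ball_holds {U : Set ℂ} : exists_conformalEquiv_ball (U := U) := by
  intro hU hsc hU'
  obtain ⟨f, hf, hbij, hinv⟩ := Complex.exists_bijOn_ball_differentiableOn_invFunOn hU hsc hU'
  exact ⟨ConformalEquiv.ofBijOn f hf hbij hinv⟩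

/-- **The Riemann mapping theorem, disc form, based** : for `U ⊊ ℂ` open and simply connected and
`z₀ ∈ U` there is a conformal equivalence `φ : U → 𝔻` with `φ z₀ = 0`. Conway VII.4.2; Ahlfors
(1979), Ch. 6 §1.1, Thm 1. [cite: AhlforsCA1979, Ch. 6 §1.1 Thm. 1] -/
theorem exists_conformalEquiv_ball_apply_eq_zero {U : Set ℂ} (hU : IsOpen U)
    (hsc : IsSimplyConnected U) (hU' : U ≠ univ) {z₀ : ℂ} (hz₀ : z₀ ∈ U) :
    ∃ φ : ConformalEquiv U (ball 0 1), φ z₀ = 0 := by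
  obtain ⟨f, hf, hbij, h0, -, hinv⟩ := Complex.exists_bijOn_ball_of_isSimplyConnected hU hsc hU' hz₀
  exact ⟨ConformalEquiv.ofBijOn f hf hbij hinv, h0⟩

/-! ### The Riemann mapping theorem, half-plane form -/

/-- **The Riemann mapping theorem, half-plane form** (`Literature.Probability.RandomPlanarGeometry.exists_conformalEquiv_upperHalfPlaneSet`
holds): every simply connected open proper subset `U ⊊ ℂ` is the image of `ℍₒ` under a conformal
equivalence `ℍₒ → U` (disc form composed with the inverse Cayley transform,
`Literature.Probability.RandomPlanarGeometry.exists_conformalEquiv_upperHalfPlaneSet_of_ball`). Ahlfors, *Complex Analysis* (1979), Ch. 6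
§1.1, Thm 1. [cite: AhlforsCA1979, Ch. 6 §1.1 Thm. 1 (with the Cayley transform)] -/
theorem exists_conformalEquiv_upperHalfPlaneSet_holds {U : Set ℂ} :
    exists_conformalEquiv_upperHalfPlaneSet (U := U) :=
  exists_conformalEquiv_upperHalfPlaneSet_of_ball exists_conformalEquiv_ball_holds

/-! ### Chordal uniformizing maps -/

/-- **Existence of chordal uniformizing maps from Jordan–Schoenflies and Carathéodory.** Every
Dobrushin domain `(D; a, b)` admits a conformal equivalence `φ : ℍₒ → D` with boundary value `a`
at `0` and `b` at `∞` (`MarkedDomain.exists_isChordalUniformizing`), given only that Jordan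
domains are simply connected (`hsc`) and Carathéodory's theorem in disc form (`hC`, Pommerenke
(1992), Thm 2.6): the Riemann-mapping hypothesis of
`MarkedDomain.exists_isChordalUniformizing_of_disc` is discharged by
`exists_conformalEquiv_ball_holds`. Lawler (2005), Ch. 6; Ahlfors (1979), Ch. 6 §1.1, Thm 1. [cite: AhlforsCA1979, Ch. 6 §1.1 Thm. 1] -/
theorem MarkedDomain.exists_isChordalUniformizing_of_caratheodory
    (hsc : ∀ D : JordanDomain, D.isSimplyConnected)
    (hC : JordanDomain.exists_continuousOn_extension) : MarkedDomain.exists_isChordalUniformizing :=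
  MarkedDomain.exists_isChordalUniformizing_of_disc hsc exists_conformalEquiv_ball_holds hC

end Literature.Probability.RandomPlanarGeometry

end
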